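import Summits.CriticalPhenomena.PercolationContinuityZ3.Theorems.Transplant.GrigorchukPowerWitnessConj4Defs
import Summits.CriticalPhenomena.PercolationContinuityZ3.Theorems.Transplant.GrigorchukSubexponentialGrowth
import HarnessLib

/-!
# `Cay(𝔊^k; standard generators)` does NOT have exponential growth — the growth input of W4's residue-node derivation, DISCHARGED in the kernel

builds on p205010 (kernel theorem, internal audit signed; external expert review pending) — nothing in this file uses p205010; pure group
combinatorics about the direct powers `𝔊^k = Fin k → 𝔊` of the tree's first Grigorchuk group and the W4 graph `Grigorchuk.gkCay k = Cay(𝔊^k; 4k standard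
generators)` («GrigorchukPowerWitnessConj4Defs» p682559).  Lane `prim-bschramm`, seat `prim-bschramm-stmt` gen 41 (port pen) under lead g28's TYPING GO
S-W4-1 #9167 (director-frontier g15 #9163 (3): the S-items of the certified third witness family W4).  Proof-only helper file
(`--supports stmt-CriticalPhenomena-4575 --as helper`): NO definition, no `@[conjecture]`, nothing about `θ(p_c)`; it discharges the ONE hypothesis that
p682559 carried (`hgr : ¬ HasExponentialGrowth (gkCay k)`, its module-docstring TODO).

THE ARGUMENT (the docstring TODO of p682559, ≈ as sized there).  The coordinate projections `𝔊^k → 𝔊`, `u ↦ u i`, are 1-Lipschitz for the word metrics: a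
standard generator of `𝔊^k` is a letter `a, b, c, d` placed in ONE coordinate (`Pi.mulSingle j y`), so along an edge of `Cay(𝔊^k; std)` every coordinate either
stays put or moves along an edge of `Cay(𝔊; a, b, c, d)` (`gkCay_adj_apply`).  Hence a walk of length `≤ n` projects to walks of length `≤ n`
(`exists_walk_apply`), the ball `B_{𝔊^k}(u, n)` lies in the product of the coordinate balls (`graphBall_gkCay_subset_pi`), and
**`|B_{𝔊^k}(1, n)| ≤ |B_𝔊(1, n)|^k`** (`ballVolume_gkCay_le_pow`).  With the tree's subexponential bound for `𝔊` («GrigorchukSubexponentialGrowth»: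
`ballVolume_le_gammaW` `|B_𝔊(1,n)| ≤ γ_w(3400 n)` and `gammaW_le_exp` `γ_w(m) ≤ K_τ e^{τ m}` for every `τ > 0`) this gives, for `τ = log c / (6800 (k+1))`,
`|B_{𝔊^k}(1, n)| ≤ K^k (√c)^n`, which refutes `c^n ≤ |B_{𝔊^k}(1, n)|` eventually for any `c > 1`: **`gkCay_not_hasExponentialGrowth (k) :
¬ HasExponentialGrowth (gkCay k)`** for EVERY `k` (the tree's eventual form «SubexponentialGrowthZd» :150, refuted at the vertex `1`; `k = 0` is the one-vertex
graph and is covered by the same inequality).  In print: a finite direct power of a group of intermediate growth has intermediate growth (Grigorchuk 1984);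
NO growth exponent is typed here (neither is one needed by any customer).

CUSTOMERS (§3, one-liners over p682559): **`gkCay_isGraphAmenable (k) : IsGraphAmenable (gkCay k)`** (Lyons–Peres §6.1 contrapositive, p682559's
`gkCay_isGraphAmenable_of_not_hasExponentialGrowth` with its hypothesis discharged) and **`gkCay_conj4_of_conj4_amenableSubexponential' (hk : 1 ≤ k)
(h : BenjaminiSchramm1996_conj4_amenableSubexponential) : gkCay_conj4 k`** — the residue-node derivation of the W4 target with NO carried hypothesis: every
scope fact of the residue node (connected, quasi-transitive, amenable, not of exponential growth, `p_c < 1`) is now KERNEL for `Cay(𝔊^k; std)`, `k ≥ 1`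
(`gkCay_residue_scope`).  The node itself is a HYPOTHESIS, never asserted; `gkCay_conj4 k`, `stdCay_conj4`, `gzCay_conj4`, the residue node and Conjecture 4 stay
OPEN; nothing here bears on their truth.
[cite: Grigorchuk1984, Thm. (subexponential growth; direct powers)] [cite: LyonsPeres2016, §6.1 (p. 279)] [cite: BenjaminiSchramm1996, Conj. 4]
-/

noncomputable section

namespace Summit.CriticalPhenomena.PercolationContinuityZ3.Theorems.Transplant

namespace Grigorchuk

open SimpleGraph Literature.Barriers.CriticalPhenomena Literature.Probability.Percolation Literature.Probability.LatticeModels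
open scoped Classical

/-! ### §1 The coordinate projections are 1-Lipschitz -/

/-- **Along an edge of `Cay(𝔊^k; std)` every coordinate stays put or moves along an edge of `Cay(𝔊; a, b, c, d)`**: the generator used is a letter in one
coordinate (`Pi.mulSingle j y`, `y ∈ {a, b, c, d}`). [cite: BenjaminiSchramm1996, §2 (Cayley graphs)] -/
theorem gkCay_adj_apply {k : ℕ} {u v : GPow k} (h : (gkCay k).Adj u v) (i : Fin k) : u i = v i ∨ stdCay.Adj (u i) (v i) := by
  rw [mulCayley_adj] at h
  obtain ⟨hne, hmem⟩ := h
  -- in either orientation the quotient is a letter `y` in one coordinate `j`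
  have key : ∀ {u v : GPow k}, u ≠ v → u⁻¹ * v ∈ (↑(gkGens k) : Set (GPow k)) → u i = v i ∨ stdCay.Adj (u i) (v i) := by
    intro u v hne hmem
    rw [Finset.mem_coe, gkGens, Finset.mem_image] at hmem
    obtain ⟨⟨j, y⟩, hjy, hprod⟩ := hmem
    rw [Finset.mem_product] at hjy
    have hv : v = u * Pi.mulSingle j y := by rw [hprod, mul_inv_cancel_left]
    by_cases hij : i = j
    · subst hij
      right
      rw [mulCayley_adj]
      refine ⟨fun heq => hne ?_, Or.inl ?_⟩
      · -- `u i = v i` with `v = u · mulSingle i y` forces `y = 1`, hence `u = v`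
        have hy : y = 1 := by
          have h1 : v i = u i * y := by rw [hv, Pi.mul_apply, Pi.mulSingle_eq_same]
          rw [← heq] at h1
          exact (mul_eq_left.mp h1.symm)
        rw [hv, hy, Pi.mulSingle_one, mul_one]
      · rw [hv, Pi.mul_apply, Pi.mulSingle_eq_same, inv_mul_cancel_left]
        exact Finset.mem_coe.2 hjy.2
    · left
      rw [hv, Pi.mul_apply, Pi.mulSingle_eq_of_ne hij, mul_one]
  rcases hmem with hmem | hmem
  · exact key hne hmem
  · rcases key hne.symm hmem with h | h
    · exact Or.inl h.symm
    · exact Or.inr h.symm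

/-- **A walk in `Cay(𝔊^k; std)` projects, coordinate by coordinate, to walks in `Cay(𝔊; a, b, c, d)` that are no longer.** [folklore] -/
theorem exists_walk_apply {k : ℕ} {u v : GPow k} (p : (gkCay k).Walk u v) (i : Fin k) :
    ∃ q : stdCay.Walk (u i) (v i), q.length ≤ p.length := by
  induction p with
  | nil => exact ⟨Walk.nil, le_rfl⟩
  | @cons x w z hadj p ih =>
    obtain ⟨q, hq⟩ := ih
    rcases gkCay_adj_apply hadj i with h | h
    · refine ⟨q.copy h.symm rfl, ?_⟩
      rw [Walk.length_copy, Walk.length_cons]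
      omega
    · exact ⟨Walk.cons h q, by rw [Walk.length_cons, Walk.length_cons]; omega⟩

/-- **`B_{𝔊^k}(u, n) ⊆ ∏_i B_𝔊(u i, n)`** (coordinate projections are 1-Lipschitz). [folklore] -/
theorem graphBall_gkCay_subset_pi (k : ℕ) (u : GPow k) (n : ℕ) :
    graphBall (gkCay k) u n ⊆ Set.pi Set.univ (fun i => graphBall stdCay (u i) n) := by
  rintro v ⟨p, hp⟩ i -
  obtain ⟨q, hq⟩ := exists_walk_apply p i
  exact ⟨q, hq.trans hp⟩

/-! ### §2 The volume bound and the growth theorem -/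

/-- **`|B_{𝔊^k}(1, n)| ≤ |B_𝔊(1, n)|^k`.** [cite: Grigorchuk1984, Thm. (direct powers)] -/
theorem ballVolume_gkCay_le_pow (k n : ℕ) : ballVolume (gkCay k) 1 n ≤ ballVolume stdCay 1 n ^ k := by
  have hfin : (graphBall stdCay (1 : ↥grigorchukGroup) n).Finite := graphBall_finite stdCay 1 n
  set B : Finset ↥grigorchukGroup := hfin.toFinset with hB
  have hsub : graphBall (gkCay k) 1 n ⊆ ↑(Fintype.piFinset fun _ : Fin k => B) := by
    intro v hv
    rw [Finset.mem_coe, Fintype.mem_piFinset]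
    intro i
    rw [hB, Set.Finite.mem_toFinset]
    have := graphBall_gkCay_subset_pi k 1 n hv i (Set.mem_univ i)
    simpa only [Pi.one_apply] using this
  calc ballVolume (gkCay k) 1 n = (graphBall (gkCay k) 1 n).ncard := rfl
    _ ≤ (↑(Fintype.piFinset fun _ : Fin k => B) : Set (GPow k)).ncard := Set.ncard_le_ncard hsub (Finset.finite_toSet _)
    _ = (Fintype.piFinset fun _ : Fin k => B).card := Set.ncard_coe_finset _
    _ = B.card ^ k := by rw [Fintype.card_piFinset, Finset.prod_const, Finset.card_univ, Fintype.card_fin]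
    _ = ballVolume stdCay 1 n ^ k := by rw [hB, ballVolume, Set.ncard_eq_toFinset_card _ hfin]

/-- **`Cay(𝔊^k; standard generators)` DOES NOT HAVE EXPONENTIAL GROWTH**, for every `k` (the tree's eventual form `∀ x ∃ c > 1, c^n ≤ |B(x,n)|` eventually —
refuted at `x = 1`): `|B_{𝔊^k}(1,n)| ≤ |B_𝔊(1,n)|^k ≤ γ_w(3400 n)^k ≤ K^k (√c)^n` contradicts `c^n ≤ |B(1,n)|`.  In print: a finite direct power of a group
of intermediate growth has intermediate growth; no exponent is typed. [cite: Grigorchuk1984, Thm. (subexponential growth; direct powers)] -/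
theorem gkCay_not_hasExponentialGrowth (k : ℕ) : ¬ HasExponentialGrowth (gkCay k) := by
  intro h
  obtain ⟨c, hc, hev⟩ := h 1
  have hc0 : 0 < c := by linarith
  have hlog : 0 < Real.log c := Real.log_pos hc
  -- `r = √c > 1`, `r² = c`
  set r : ℝ := Real.exp (Real.log c / 2) with hr
  have hr1 : 1 < r := by rw [hr]; exact Real.one_lt_exp_iff.2 (by positivity)
  have hr0 : 0 < r := by linarith
  have hrr : r * r = c := by rw [hr, ← Real.exp_add, add_halves, Real.exp_log hc0]
  -- rate `τ = log c / (6800 (k+1))`: then `(e^{τ · 3400 n})^k = e^{(k/(k+1)) (log c / 2) n} ≤ r^n`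
  obtain ⟨K, hK⟩ := gammaW_le_exp (show 0 < Real.log c / (6800 * ((k : ℝ) + 1)) by positivity)
  have hK0 : 0 ≤ K := by
    have h0 := hK 0
    have : (1 : ℝ) ≤ gammaW 0 := by exact_mod_cast gammaW_pos 0
    rw [Nat.cast_zero, mul_zero, Real.exp_zero, mul_one] at h0
    linarith
  have hbound : ∀ᶠ n : ℕ in Filter.atTop, r ^ n ≤ K ^ k := by
    filter_upwards [hev] with n hn
    -- the volume chain, in `ℝ`
    have h1 : (ballVolume (gkCay k) 1 n : ℝ) ≤ (ballVolume stdCay 1 n : ℝ) ^ k := by exact_mod_cast ballVolume_gkCay_le_pow k n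
    have h2 : (ballVolume stdCay 1 n : ℝ) ≤ gammaW (3400 * n) := by exact_mod_cast ballVolume_le_gammaW n
    have h3 := hK (3400 * n)
    have h4 : Real.exp (Real.log c / (6800 * ((k : ℝ) + 1)) * ((3400 * n : ℕ) : ℝ)) ^ k ≤ r ^ n := by
      rw [← Real.exp_nat_mul, hr, ← Real.exp_nat_mul]
      refine Real.exp_le_exp.2 ?_
      have hk1 : (k : ℝ) / ((k : ℝ) + 1) ≤ 1 := (div_le_one (by positivity)).2 (by linarith)
      have hn0 : (0 : ℝ) ≤ n := Nat.cast_nonneg n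
      have e : (k : ℝ) * (Real.log c / (6800 * ((k : ℝ) + 1)) * ((3400 * n : ℕ) : ℝ)) =
          (k : ℝ) / ((k : ℝ) + 1) * (Real.log c / 2 * n) := by
        push_cast; field_simp; ring
      rw [e]
      calc (k : ℝ) / ((k : ℝ) + 1) * (Real.log c / 2 * n) ≤ 1 * (Real.log c / 2 * n) :=
            mul_le_mul_of_nonneg_right hk1 (by positivity)
        _ = (n : ℝ) * (Real.log c / 2) := by ring
    have h5 : (ballVolume stdCay 1 n : ℝ) ^ k ≤ (K * Real.exp (Real.log c / (6800 * ((k : ℝ) + 1)) * ((3400 * n : ℕ) : ℝ))) ^ k :=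
      pow_le_pow_left₀ (Nat.cast_nonneg _) (h2.trans h3) k
    have h6 : c ^ n ≤ K ^ k * r ^ n := by
      calc c ^ n ≤ (ballVolume (gkCay k) 1 n : ℝ) := hn
        _ ≤ (K * Real.exp (Real.log c / (6800 * ((k : ℝ) + 1)) * ((3400 * n : ℕ) : ℝ))) ^ k := h1.trans h5
        _ = K ^ k * Real.exp (Real.log c / (6800 * ((k : ℝ) + 1)) * ((3400 * n : ℕ) : ℝ)) ^ k := mul_pow _ _ _
        _ ≤ K ^ k * r ^ n := mul_le_mul_of_nonneg_left h4 (pow_nonneg hK0 k)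
    have h7 : c ^ n = r ^ n * r ^ n := by rw [← mul_pow, hrr]
    rw [h7] at h6
    exact le_of_mul_le_mul_right (by linarith [h6, mul_comm (K ^ k) (r ^ n)]) (pow_pos hr0 n)
  have hgrow := (tendsto_pow_atTop_atTop_of_one_lt hr1).eventually_gt_atTop (K ^ k)
  obtain ⟨n, hn1, hn2⟩ := (hbound.and hgrow).exists
  exact absurd hn1 (not_le.2 hn2)

/-! ### §3 Customers: amenability, the residue node's scope, the hypothesis-free derivation of the W4 target from the residue node -/

/-- **`Cay(𝔊^k; std)` is amenable** (quasi-transitive of subexponential growth; p682559's `gkCay_isGraphAmenable_of_not_hasExponentialGrowth` with its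
hypothesis discharged). [cite: LyonsPeres2016, §6.1 (p. 279)] [cite: Grigorchuk1984, Thm. (subexponential growth; direct powers)] -/
theorem gkCay_isGraphAmenable (k : ℕ) : IsGraphAmenable (gkCay k) :=
  gkCay_isGraphAmenable_of_not_hasExponentialGrowth (gkCay_not_hasExponentialGrowth k)

/-- **Every scope fact of the residue node is KERNEL for `Cay(𝔊^k; std)`, `k ≥ 1`**: connected, quasi-transitive, amenable, not of exponential growth,
`p_c < 1` at every vertex. [cite: BenjaminiSchramm1996, Conj. 4] [cite: MuchnikPak2001, Thm. 1] -/
theorem gkCay_residue_scope {k : ℕ} (hk : 1 ≤ k) :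
    (gkCay k).Connected ∧ IsQuasiTransitive (gkCay k) ∧ IsGraphAmenable (gkCay k) ∧ ¬ HasExponentialGrowth (gkCay k) ∧
      ∀ v : GPow k, criticalProb (gkCay k) v < 1 :=
  ⟨gkCay_connected k, gkCay_isQuasiTransitive k, gkCay_isGraphAmenable k, gkCay_not_hasExponentialGrowth k, gkCay_criticalProb_lt_one hk⟩

/-- **The residue node implies the W4 target `gkCay_conj4 k` for every `k ≥ 1` — NO carried hypothesis** (p682559's
`gkCay_conj4_of_conj4_amenableSubexponential` with `hgr` discharged by `gkCay_not_hasExponentialGrowth`).  The node is a HYPOTHESIS here, never asserted;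
`gkCay_conj4 k` stays OPEN. [cite: BenjaminiSchramm1996, Conj. 4] [cite: Grigorchuk1984, Thm. (subexponential growth; direct powers)] -/
theorem gkCay_conj4_of_conj4_amenableSubexponential' {k : ℕ} (hk : 1 ≤ k) (h : BenjaminiSchramm1996_conj4_amenableSubexponential) :
    gkCay_conj4 k :=
  gkCay_conj4_of_conj4_amenableSubexponential hk (gkCay_not_hasExponentialGrowth k) h

end Grigorchuk

end Summit.CriticalPhenomena.PercolationContinuityZ3.Theorems.Transplant

end
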